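/-
Copyright (c) 2026 the pub-hodgecm-mathlib formalisation cell (harness21).  Prover seat hodgecm-mathlib-LH4-p14 (g2), req620 Track A «(D-RAM) FOUR-FRAME» squad
(unit U3_Laws, MS ROAD A Stage B; brick B10 PART 2 «BOX RE-INDEX» dealt by the Stage-B lead LH4-p10 (g2) 2026-09-04T00:09:27Z; MS ledger LH4-p11 (g2); dealer LH4-plan (g11)).  2026-09-04.
-/
import Summits.HodgeConjecture.HodgeConjecture.Theorems.F0P3cDyRamStableCountBoxReindex   -- B10 PART 2 FILE 1 (this seat): the engine (§1–§4)
import HarnessLib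

/-!
# Crux `H413`, line LH4 «(D-RAM) FOUR-FRAME» road — unit U3_Laws (iii), MS ROAD A Stage B, brick B10 PART 2 «BOX RE-INDEX», FILE 2∕3: THE PARITY-GENERIC ASSEMBLY —
# `Σ_{a : Fin 3 → Fin (B+1)} v a` = ★ B8's per-plane class sum, hence `(q − 1)·Σ_a v a = q^k − 1`

Cell `hodgecm-mathlib` (D-0151), FLOOR 0, crux item H413 = `stmt-HodgeConjecture-24833`, route of record `HCCMUnconditional`; squad F0∕P3c∕LH4 (req618∕req620).  THEOREMS ONLY;
lane `--supports stmt-HodgeConjecture-24833 --as helper` (count-neutral).  For `v : (Fin 3 → ℕ) → ℚ` following the Stage-B stub table at parity `P` — core `[P=0]` at `(0,0,0)`,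
on-branch values at `(0,s,s)`, `(s,0,s)`, `(s,s,0)` (`s ≥ 1`), glued-tube + glue-shell values at `(r,r+s,r+s)` and its two permutations (`r ≥ 1`, `r ≡ P`, `s ≥ 1`), hanging +
equilateral-glue values at `(r,r,r)` (`r ≥ 1`, `r ≡ P`), and `v = 0` off that shape list — over an ISOCELES key `(n₁,n₂,n₃)` in datum order with `nᵢ ≡ d (mod 2)`,
`1 ≤ d ≤ min nᵢ`, `Σnᵢ ≤ B`:
* `sum_box_eq_planes` — the box sum equals the PER-PLANE class sum of ★ `stableCountSum_planes` at parity `P` (FILE 1's diagonal + three planes; the `hiso` case analysis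
  places the ONE live glue term: the special plane's if non-equilateral, the diagonal's if equilateral);
* `sum_box_mul_eq` — with `2k + d = n₁ + n₂ + n₃ + 2`: **`(q − 1)·Σ_{a} v a = q^k − 1`** (★ `stableCountSum_planes_of_shift`).
FILE 3 instantiates LH4-p10 (g2)'s type-0 ∕ type-2 SKELETON stub tables VERBATIM.
HONEST LABEL.  Count-neutral (`--supports`); finite-sum bookkeeping, nothing printed is asserted; (MS) stays a PROVER TARGET until B10 ⊕ B10₂ ⊕ (O2c) land; `HC_CM` is proved only modulo
the 7 printed citations (2 remaining named inputs: hLiu418 = `stmt-HodgeConjecture-24832`, h413 = `stmt-HodgeConjecture-24833`) until rung 0 closes.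

## References
* [Rogawski1990] J. D. Rogawski, *Automorphic Representations of Unitary Groups in Three Variables*, Ann. of Math. Stud. 123 (1990), §4.9 Prop. 4.9.1 (a) p. 55.
* [Kottwitz1986BaseChangeUnits] R. E. Kottwitz, *Base change for unit elements of Hecke algebras*, Compositio Math. 60 (1986), §1 pp. 240–241.
-/

set_option autoImplicit false

namespace Summit.HodgeConjecture.HodgeConjecture.Cruxes.H413.F0P3cDyRamStableCountBoxReindexPlanes

open Finset
open Summit.HodgeConjecture.HodgeConjecture.Cruxes.H413.F0P3cDyRamStableCountBoxReindex

/-! ## §5  The assembly: the box sum of the stub table is ★ B8's per-plane class sum -/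

/-- **«BOX RE-INDEX», PARITY-GENERIC.**  Let `v : (Fin 3 → ℕ) → ℚ` follow the Stage-B stub table at parity `P` (core, on-branch, glued tube + glue shell for each plane, hanging +
equilateral glue on the diagonal) and vanish off the shape list, for an ISOCELES key `(n₁,n₂,n₃)` in datum order with `nᵢ ≡ d (mod 2)`, `1 ≤ d ≤ min nᵢ`, bound `Σnᵢ ≤ B`.
Then the box sum `Σ_{a : Fin 3 → Fin (B+1)} v a` equals the PER-PLANE class sum of ★ `stableCountSum_planes` at parity `P`. [folklore] -/
theorem sum_box_eq_planes (q P : ℕ) {d n₁ n₂ n₃ B : ℕ} (hd : 1 ≤ d)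
    (hiso : (n₁ = n₂ ∧ n₁ ≤ n₃) ∨ (n₁ = n₃ ∧ n₁ ≤ n₂) ∨ (n₂ = n₃ ∧ n₂ ≤ n₁))
    (hdn : d ≤ min n₁ (min n₂ n₃)) (h1 : n₁ % 2 = d % 2) (h2 : n₂ % 2 = d % 2) (h3 : n₃ % 2 = d % 2) (hB : n₁ + n₂ + n₃ ≤ B)
    (v : (Fin 3 → ℕ) → ℚ)
    (hcore : v ![0, 0, 0] = if P = 0 then 1 else 0)
    (hT1 : ∀ s, 1 ≤ s → v ![0, s, s] = if s % 2 = P ∧ s ≤ n₁ then (q : ℚ) ^ (s / 2) else 0)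
    (hT2 : ∀ s, 1 ≤ s → v ![s, 0, s] = if s % 2 = P ∧ s ≤ n₂ then (q : ℚ) ^ (s / 2) else 0)
    (hT3 : ∀ s, 1 ≤ s → v ![s, s, 0] = if s % 2 = P ∧ s ≤ n₃ then (q : ℚ) ^ (s / 2) else 0)
    (hG1 : ∀ r s, 1 ≤ r → r % 2 = P → 1 ≤ s → v ![r, r + s, r + s] =
      (if s % 2 = 0 ∧ r ≤ min n₂ n₃ ∧ r + s ≤ n₁ then ((q : ℚ) - 1) * (q : ℚ) ^ (r + s / 2 - 1) else 0) +
      (if s % 2 = 0 ∧ n₂ = n₃ ∧ n₁ = n₂ + s ∧ n₂ < r ∧ r - n₂ ≤ n₂ - d + 1 then (q : ℚ) ^ (r + s / 2 - (r - n₂ + 1) / 2) else 0))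
    (hG2 : ∀ r s, 1 ≤ r → r % 2 = P → 1 ≤ s → v ![r + s, r, r + s] =
      (if s % 2 = 0 ∧ r ≤ min n₁ n₃ ∧ r + s ≤ n₂ then ((q : ℚ) - 1) * (q : ℚ) ^ (r + s / 2 - 1) else 0) +
      (if s % 2 = 0 ∧ n₁ = n₃ ∧ n₂ = n₁ + s ∧ n₁ < r ∧ r - n₁ ≤ n₁ - d + 1 then (q : ℚ) ^ (r + s / 2 - (r - n₁ + 1) / 2) else 0))
    (hG3 : ∀ r s, 1 ≤ r → r % 2 = P → 1 ≤ s → v ![r + s, r + s, r] =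
      (if s % 2 = 0 ∧ r ≤ min n₁ n₂ ∧ r + s ≤ n₃ then ((q : ℚ) - 1) * (q : ℚ) ^ (r + s / 2 - 1) else 0) +
      (if s % 2 = 0 ∧ n₁ = n₂ ∧ n₃ = n₁ + s ∧ n₁ < r ∧ r - n₁ ≤ n₁ - d + 1 then (q : ℚ) ^ (r + s / 2 - (r - n₁ + 1) / 2) else 0))
    (hH : ∀ r, 1 ≤ r → r % 2 = P → v ![r, r, r] =
      (if r ≤ min n₁ (min n₂ n₃) then ((q : ℚ) - 2) * (q : ℚ) ^ (r - 1) else 0) +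
      (if n₁ = n₂ ∧ n₂ = n₃ ∧ n₁ < r ∧ r - n₁ ≤ n₁ - d + 1 then (q : ℚ) ^ (r - (r - n₁ + 1) / 2) else 0))
    (hzero : ∀ a, v a ≠ 0 → a = ![0, 0, 0] ∨ (∃ s, 1 ≤ s ∧ (a = ![0, s, s] ∨ a = ![s, 0, s] ∨ a = ![s, s, 0])) ∨
      (∃ r s, 1 ≤ r ∧ r % 2 = P ∧ 1 ≤ s ∧ (a = ![r, r + s, r + s] ∨ a = ![r + s, r, r + s] ∨ a = ![r + s, r + s, r])) ∨
      (∃ r, 1 ≤ r ∧ r % 2 = P ∧ a = ![r, r, r])) :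
    ∑ a : Fin 3 → Fin (B + 1), v (fun i => (a i : ℕ)) =
      ((if P = 0 then (1 : ℚ) else 0)
        + ∑ s ∈ (Icc 1 n₁).filter (fun s => s % 2 = P), (q : ℚ) ^ (s / 2)
        + ∑ s ∈ (Icc 1 n₂).filter (fun s => s % 2 = P), (q : ℚ) ^ (s / 2)
        + ∑ s ∈ (Icc 1 n₃).filter (fun s => s % 2 = P), (q : ℚ) ^ (s / 2)
        + ∑ r ∈ (Icc 1 (min n₂ n₃)).filter (fun r => r % 2 = P),
            ∑ s ∈ (Icc 2 (n₁ - r)).filter (fun s => s % 2 = 0), ((q : ℚ) - 1) * (q : ℚ) ^ (r + s / 2 - 1)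
        + ∑ r ∈ (Icc 1 (min n₁ n₃)).filter (fun r => r % 2 = P),
            ∑ s ∈ (Icc 2 (n₂ - r)).filter (fun s => s % 2 = 0), ((q : ℚ) - 1) * (q : ℚ) ^ (r + s / 2 - 1)
        + ∑ r ∈ (Icc 1 (min n₁ n₂)).filter (fun r => r % 2 = P),
            ∑ s ∈ (Icc 2 (n₃ - r)).filter (fun s => s % 2 = 0), ((q : ℚ) - 1) * (q : ℚ) ^ (r + s / 2 - 1)
        + ∑ r ∈ (Icc (min n₁ (min n₂ n₃) + 1) (2 * min n₁ (min n₂ n₃))).filter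
              (fun r => r % 2 = P ∧ r - min n₁ (min n₂ n₃) ≤ min n₁ (min n₂ n₃) - d + 1),
            (q : ℚ) ^ (r + (max n₁ (max n₂ n₃) - min n₁ (min n₂ n₃)) / 2 - (r - min n₁ (min n₂ n₃) + 1) / 2)
        + ∑ r ∈ (Icc 1 (min n₁ (min n₂ n₃))).filter (fun r => r % 2 = P), ((q : ℚ) - 2) * (q : ℚ) ^ (r - 1)) := by
  -- shape consequences of `hzero`
  have hz_diag : ∀ r, 1 ≤ r → r % 2 ≠ P → v ![r, r, r] = 0 := by
    intro r hr hrP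
    by_contra hne
    rcases hzero _ hne with h | ⟨s, hs, h | h | h⟩ | ⟨r', s, hr', hr'P, hs, h | h | h⟩ | ⟨r', hr', hr'P, h⟩ <;>
      rw [vec3_eq_iff] at h <;> omega
  have hz_plane1 : ∀ r s, 1 ≤ r → r % 2 ≠ P → 1 ≤ s → v ![r, r + s, r + s] = 0 := by
    intro r s hr hrP hs1
    by_contra hne
    rcases hzero _ hne with h | ⟨s', hs', h | h | h⟩ | ⟨r', s', hr', hr'P, hs', h | h | h⟩ | ⟨r', hr', hr'P, h⟩ <;>
      rw [vec3_eq_iff] at h <;> omega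
  have hz_plane2 : ∀ r s, 1 ≤ r → r % 2 ≠ P → 1 ≤ s → v ![r + s, r, r + s] = 0 := by
    intro r s hr hrP hs1
    by_contra hne
    rcases hzero _ hne with h | ⟨s', hs', h | h | h⟩ | ⟨r', s', hr', hr'P, hs', h | h | h⟩ | ⟨r', hr', hr'P, h⟩ <;>
      rw [vec3_eq_iff] at h <;> omega
  have hz_plane3 : ∀ r s, 1 ≤ r → r % 2 ≠ P → 1 ≤ s → v ![r + s, r + s, r] = 0 := by
    intro r s hr hrP hs1
    by_contra hne
    rcases hzero _ hne with h | ⟨s', hs', h | h | h⟩ | ⟨r', s', hr', hr'P, hs', h | h | h⟩ | ⟨r', hr', hr'P, h⟩ <;>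
      rw [vec3_eq_iff] at h <;> omega
  have hreg : ∀ x y z : ℕ, v ![x, y, z] ≠ 0 → (x = y ∧ y = z) ∨ (y = z ∧ x < y) ∨ (x = z ∧ y < x) ∨ (x = y ∧ z < x) := by
    intro x y z hne
    rcases hzero _ hne with h | ⟨s, hs, h | h | h⟩ | ⟨r, s, hr, -, hs, h | h | h⟩ | ⟨r, -, -, h⟩ <;>
      rw [vec3_eq_iff] at h <;> omega
  have hm₁ : min n₁ (min n₂ n₃) ≤ n₁ := min_le_left _ _
  have hm₂ : min n₁ (min n₂ n₃) ≤ n₂ := le_trans (min_le_right _ _) (min_le_left _ _)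
  have hm₃ : min n₁ (min n₂ n₃) ≤ n₃ := le_trans (min_le_right _ _) (min_le_right _ _)
  rw [sum_box_eq_triple_sum, triple_sum_eq_diag_add_planes B v hreg,
    diag_sum_eq q P hd hdn hB (fun r => v ![r, r, r]) hcore hH hz_diag,
    plane_sum_eq q P (n := n₁) (n' := n₂) (n'' := n₃) hd (le_trans hdn hm₂) (by omega) (fun r t => v ![r, t, t]) hT1 hG1 hz_plane1,
    plane_sum_eq q P (n := n₂) (n' := n₁) (n'' := n₃) hd (le_trans hdn hm₁) (by omega) (fun r t => v ![t, r, t]) hT2 hG2 hz_plane2,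
    plane_sum_eq q P (n := n₃) (n' := n₁) (n'' := n₂) hd (le_trans hdn hm₁) (by omega) (fun r t => v ![t, t, r]) hT3 hG3 hz_plane3]
  -- the glue bookkeeping: exactly one of the four glue terms is the glue block of the bracket
  have hglue :
      (if n₁ = n₂ ∧ n₂ = n₃ then
          ∑ r ∈ (Icc (n₁ + 1) (2 * n₁)).filter (fun r => r % 2 = P ∧ r - n₁ ≤ n₁ - d + 1), (q : ℚ) ^ (r - (r - n₁ + 1) / 2) else 0)
      + (if n₂ = n₃ ∧ n₂ < n₁ ∧ (n₁ - n₂) % 2 = 0 then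
          ∑ r ∈ (Icc (n₂ + 1) (2 * n₂)).filter (fun r => r % 2 = P ∧ r - n₂ ≤ n₂ - d + 1), (q : ℚ) ^ (r + (n₁ - n₂) / 2 - (r - n₂ + 1) / 2) else 0)
      + (if n₁ = n₃ ∧ n₁ < n₂ ∧ (n₂ - n₁) % 2 = 0 then
          ∑ r ∈ (Icc (n₁ + 1) (2 * n₁)).filter (fun r => r % 2 = P ∧ r - n₁ ≤ n₁ - d + 1), (q : ℚ) ^ (r + (n₂ - n₁) / 2 - (r - n₁ + 1) / 2) else 0)
      + (if n₁ = n₂ ∧ n₁ < n₃ ∧ (n₃ - n₁) % 2 = 0 then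
          ∑ r ∈ (Icc (n₁ + 1) (2 * n₁)).filter (fun r => r % 2 = P ∧ r - n₁ ≤ n₁ - d + 1), (q : ℚ) ^ (r + (n₃ - n₁) / 2 - (r - n₁ + 1) / 2) else 0)
      = ∑ r ∈ (Icc (min n₁ (min n₂ n₃) + 1) (2 * min n₁ (min n₂ n₃))).filter
              (fun r => r % 2 = P ∧ r - min n₁ (min n₂ n₃) ≤ min n₁ (min n₂ n₃) - d + 1),
            (q : ℚ) ^ (r + (max n₁ (max n₂ n₃) - min n₁ (min n₂ n₃)) / 2 - (r - min n₁ (min n₂ n₃) + 1) / 2) := by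
    rcases hiso with ⟨h12, h13⟩ | ⟨h13, h12⟩ | ⟨h23, h21⟩
    · rcases Nat.lt_or_ge n₁ n₃ with hlt | hge
      · have em : min n₁ (min n₂ n₃) = n₁ := by omega
        have eM : max n₁ (max n₂ n₃) = n₃ := by omega
        rw [if_neg (by omega), if_neg (by omega), if_neg (by omega), if_pos ⟨h12, hlt, by omega⟩, em, eM]; ring
      · have e3 : n₃ = n₁ := le_antisymm hge h13
        have em : min n₁ (min n₂ n₃) = n₁ := by omega
        have eM : max n₁ (max n₂ n₃) = n₁ := by omega
        rw [if_pos ⟨h12, by omega⟩, if_neg (by omega), if_neg (by omega), if_neg (by omega), em, eM, Nat.sub_self, Nat.zero_div]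
        simp only [add_zero]
    · rcases Nat.lt_or_ge n₁ n₂ with hlt | hge
      · have em : min n₁ (min n₂ n₃) = n₁ := by omega
        have eM : max n₁ (max n₂ n₃) = n₂ := by omega
        rw [if_neg (by omega), if_neg (by omega), if_pos ⟨h13, hlt, by omega⟩, if_neg (by omega), em, eM]; ring
      · have e2 : n₂ = n₁ := le_antisymm hge h12
        have em : min n₁ (min n₂ n₃) = n₁ := by omega
        have eM : max n₁ (max n₂ n₃) = n₁ := by omega
        rw [if_pos ⟨by omega, by omega⟩, if_neg (by omega), if_neg (by omega), if_neg (by omega), em, eM, Nat.sub_self, Nat.zero_div]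
        simp only [add_zero]
    · rcases Nat.lt_or_ge n₂ n₁ with hlt | hge
      · have em : min n₁ (min n₂ n₃) = n₂ := by omega
        have eM : max n₁ (max n₂ n₃) = n₁ := by omega
        rw [if_neg (by omega), if_pos ⟨h23, hlt, by omega⟩, if_neg (by omega), if_neg (by omega), em, eM]; ring
      · have e1 : n₁ = n₂ := le_antisymm hge h21
        have em : min n₁ (min n₂ n₃) = n₁ := by omega
        have eM : max n₁ (max n₂ n₃) = n₁ := by omega
        rw [if_pos ⟨e1, h23⟩, if_neg (by omega), if_neg (by omega), if_neg (by omega), em, eM, Nat.sub_self, Nat.zero_div]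
        simp only [add_zero]
  linear_combination hglue

/-- **«BOX RE-INDEX», PARITY-GENERIC, WITH THE LAW**: under the hypotheses of `sum_box_eq_planes` and the shift `2k + d = n₁ + n₂ + n₃ + 2`:
`(q − 1)·Σ_{a} v a = q^k − 1` (★ `stableCountSum_planes_of_shift`). [cite: Rogawski1990, §4.9 Prop. 4.9.1 (a) p. 55] -/
theorem sum_box_mul_eq (q P : ℕ) {d n₁ n₂ n₃ B k : ℕ} (hP : P ≤ 1) (hd : 1 ≤ d)
    (hiso : (n₁ = n₂ ∧ n₁ ≤ n₃) ∨ (n₁ = n₃ ∧ n₁ ≤ n₂) ∨ (n₂ = n₃ ∧ n₂ ≤ n₁))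
    (hdn : d ≤ min n₁ (min n₂ n₃)) (h1 : n₁ % 2 = d % 2) (h2 : n₂ % 2 = d % 2) (h3 : n₃ % 2 = d % 2) (hB : n₁ + n₂ + n₃ ≤ B)
    (hk : 2 * k + d = n₁ + n₂ + n₃ + 2) (v : (Fin 3 → ℕ) → ℚ)
    (hcore : v ![0, 0, 0] = if P = 0 then 1 else 0)
    (hT1 : ∀ s, 1 ≤ s → v ![0, s, s] = if s % 2 = P ∧ s ≤ n₁ then (q : ℚ) ^ (s / 2) else 0)
    (hT2 : ∀ s, 1 ≤ s → v ![s, 0, s] = if s % 2 = P ∧ s ≤ n₂ then (q : ℚ) ^ (s / 2) else 0)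
    (hT3 : ∀ s, 1 ≤ s → v ![s, s, 0] = if s % 2 = P ∧ s ≤ n₃ then (q : ℚ) ^ (s / 2) else 0)
    (hG1 : ∀ r s, 1 ≤ r → r % 2 = P → 1 ≤ s → v ![r, r + s, r + s] =
      (if s % 2 = 0 ∧ r ≤ min n₂ n₃ ∧ r + s ≤ n₁ then ((q : ℚ) - 1) * (q : ℚ) ^ (r + s / 2 - 1) else 0) +
      (if s % 2 = 0 ∧ n₂ = n₃ ∧ n₁ = n₂ + s ∧ n₂ < r ∧ r - n₂ ≤ n₂ - d + 1 then (q : ℚ) ^ (r + s / 2 - (r - n₂ + 1) / 2) else 0))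
    (hG2 : ∀ r s, 1 ≤ r → r % 2 = P → 1 ≤ s → v ![r + s, r, r + s] =
      (if s % 2 = 0 ∧ r ≤ min n₁ n₃ ∧ r + s ≤ n₂ then ((q : ℚ) - 1) * (q : ℚ) ^ (r + s / 2 - 1) else 0) +
      (if s % 2 = 0 ∧ n₁ = n₃ ∧ n₂ = n₁ + s ∧ n₁ < r ∧ r - n₁ ≤ n₁ - d + 1 then (q : ℚ) ^ (r + s / 2 - (r - n₁ + 1) / 2) else 0))
    (hG3 : ∀ r s, 1 ≤ r → r % 2 = P → 1 ≤ s → v ![r + s, r + s, r] =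
      (if s % 2 = 0 ∧ r ≤ min n₁ n₂ ∧ r + s ≤ n₃ then ((q : ℚ) - 1) * (q : ℚ) ^ (r + s / 2 - 1) else 0) +
      (if s % 2 = 0 ∧ n₁ = n₂ ∧ n₃ = n₁ + s ∧ n₁ < r ∧ r - n₁ ≤ n₁ - d + 1 then (q : ℚ) ^ (r + s / 2 - (r - n₁ + 1) / 2) else 0))
    (hH : ∀ r, 1 ≤ r → r % 2 = P → v ![r, r, r] =
      (if r ≤ min n₁ (min n₂ n₃) then ((q : ℚ) - 2) * (q : ℚ) ^ (r - 1) else 0) +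
      (if n₁ = n₂ ∧ n₂ = n₃ ∧ n₁ < r ∧ r - n₁ ≤ n₁ - d + 1 then (q : ℚ) ^ (r - (r - n₁ + 1) / 2) else 0))
    (hzero : ∀ a, v a ≠ 0 → a = ![0, 0, 0] ∨ (∃ s, 1 ≤ s ∧ (a = ![0, s, s] ∨ a = ![s, 0, s] ∨ a = ![s, s, 0])) ∨
      (∃ r s, 1 ≤ r ∧ r % 2 = P ∧ 1 ≤ s ∧ (a = ![r, r + s, r + s] ∨ a = ![r + s, r, r + s] ∨ a = ![r + s, r + s, r])) ∨
      (∃ r, 1 ≤ r ∧ r % 2 = P ∧ a = ![r, r, r])) :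
    ((q : ℚ) - 1) * ∑ a : Fin 3 → Fin (B + 1), v (fun i => (a i : ℕ)) = (q : ℚ) ^ k - 1 := by
  rw [sum_box_eq_planes q P hd hiso hdn h1 h2 h3 hB v hcore hT1 hT2 hT3 hG1 hG2 hG3 hH hzero]
  exact Summit.HodgeConjecture.HodgeConjecture.Cruxes.H413.F0P3cDyRamStableCountSumPlanes.stableCountSum_planes_of_shift q hP hd hiso hdn h1 h2 h3 hk


end Summit.HodgeConjecture.HodgeConjecture.Cruxes.H413.F0P3cDyRamStableCountBoxReindexPlanes
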